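import Summits.QuantumFields.YangMills.Theorems.AllWindowsColdBoxBoxHighLineLatticeSobolev
import Summits.QuantumFields.YangMills.Theorems.AllWindowsColdBoxBoxHighLineHodgePoincareStub
import Summits.QuantumFields.YangMills.Theorems.AllWindowsColdBoxBoxHighLineGradKernelEnergy

/-!
# LINE-19 «landau-sector-relative-bl»: S3a `LandauVarianceBounded` — bounded Landau variances of the cold box
# (crux `AllWindowsColdBox.BoxHighWindowsSU22`, stmt-QuantumFields-24004 / low item 24335; first conjunct of registered stub S3)

**Theorem (`landauVarianceBounded : LandauVarianceBounded`).**  For every `H ≥ 1` and every free edge `e` of the cold box,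
`((hodgeQ H)⁻¹)_{ee} ≤ 1036` (planner's numerics I20e: `0.431`, flat in `H`).  This is exactly the input of the planner's proved
T4″ `gradKernelL2_of_varianceBounded` (STUB-PLAN-S4b §11) for the S4b bootstrap; the decay conjunct S3b `LandauKernelDecay` of the
registered stub `stub_landauKernelBounds` is NOT proved here.  COROLLARY (`gradKernelL2 : GradKernelL2`, T4″ of the S4b bootstrap,
unconditional): by the tree's `gradKernelL2_of_varianceBounded` (✓ `…BoxHighLineGradKernelEnergy`, planner ym-idea-2 g16 / w5).
Proof: `(Q⁻¹)_{ee} = w_e` for `w = Q⁻¹δ_e`, and `wᵀQw = w_e`, so a POINTWISE bound `v_e² ≤ c·vᵀQv ∀v` gives `(Q⁻¹)_{ee} ≤ c`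
(`inv_diag_le_of_pointwise`).  The pointwise bound (`sq_le_hodge`, `c = 1036`): with the zero extension `u` of `v` and its CORE part
`uc` (edges with all transverse coordinates in `[1,2H−1]`), `u_e² = uc_e² + (u−uc)_e²`; the face-tangential value is paid by the exterior
plaquettes (`boundary_reduction`, ✓S1 part 4: `‖u − uc‖² ≤ 4·Σ circ²`), the core value by the LATTICE SOBOLEV inequality on the slice
through the edge normal to its direction (`lattice_sobolev`: `uc(x,i)² ≤ 4·Σ_{τ≠i}‖∇_τ uc_i‖²`, simplex flow / transience of `ℤ³`)
followed by the core energy bound (`core_energy`, ✓S1 part 2) and `F(uc) ≤ 258·F(u)`.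
HONEST LABEL: one half (S3a) of a registered stub of a critic-PASSed DRAFT-by-design line on the R2ξ″ crux ⟨24004⟩; S3b, S4b, S5 open;
no crux, rung or summit is proved; the Yang–Mills mass gap is NOT proved by this file.
-/

set_option autoImplicit false

namespace Summit.QuantumFields.YangMills.Theorems.AllWindowsColdBoxBoxHighLine

open Finset Matrix
open Literature.Probability.LatticeModels (Site)
open Literature.MathematicalPhysics.QuantumFieldTheory
open Literature.MathematicalPhysics.QuantumFieldTheory.LatticeMaxwell
open Literature.MathematicalPhysics.QuantumFieldTheory.AxialGauge
open Summit.QuantumFields.YangMills.Theorems.WeakCouplingRates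

namespace HodgePoincare

/-- **Pointwise bound of an edge value by the Hodge form** (function form).  For every real edge function `u` supported on the
edges of the cube `[0,N]⁴` (`N ≥ 1`) and every edge `(x, i)`:
`u(x,i)² ≤ 1036·(Σ_plaquettes circ² + Σ_{interior sites} div²)`.
The face-tangential part is paid by the exterior plaquettes (`boundary_reduction`), the core part by the lattice Sobolev inequality on the
slice through `x` normal to `i` (`lattice_sobolev`) and the core energy bound (`core_energy`). -/
theorem sq_le_hodge (N : ℕ) (u : (Fin 4 → ℤ) × Fin 4 → ℝ)
    (hsupp : ∀ x i, u (x, i) ≠ 0 → (∀ k, 0 ≤ x k ∧ x k ≤ N) ∧ x i + 1 ≤ N) (x : Fin 4 → ℤ) (i : Fin 4) :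
    u (x, i) ^ 2 ≤ 1036 *
      (∑ z ∈ Fintype.piFinset (fun _ : Fin 4 => Finset.Icc (-2 : ℤ) (N + 2)), ∑ i : Fin 4, ∑ j : Fin 4,
          (if i < j then (u (z, i) + u (z + Pi.single i 1, j) - u (z + Pi.single j 1, i) - u (z, j)) ^ 2 else 0) +
        ∑ x ∈ Fintype.piFinset (fun _ : Fin 4 => Finset.Icc (1 : ℤ) (N - 1)),
          (∑ i : Fin 4, (u (x - Pi.single i 1, i) - u (x, i))) ^ 2) := by
  classical
  -- the core part
  obtain ⟨uc, huc⟩ : ∃ uc : (Fin 4 → ℤ) × Fin 4 → ℝ,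
      ∀ x i, uc (x, i) = if (∀ k, k ≠ i → 1 ≤ x k ∧ x k + 1 ≤ N) then u (x, i) else 0 :=
    ⟨fun e => if (∀ k, k ≠ e.2 → 1 ≤ e.1 k ∧ e.1 k + 1 ≤ N) then u e else 0, fun _ _ => rfl⟩
  have hcsupp : ∀ x i, uc (x, i) ≠ 0 → ∀ k, 0 ≤ x k ∧ x k ≤ N := by
    intro x i h
    rw [huc] at h
    split_ifs at h with hc
    · exact (hsupp x i h).1
    · exact absurd rfl h
  have hccore : ∀ x i, uc (x, i) ≠ 0 → ∀ k, k ≠ i → 1 ≤ x k ∧ x k + 1 ≤ N := by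
    intro x i h
    rw [huc] at h
    split_ifs at h with hc
    · exact hc
    · exact absurd rfl h
  have hnorm : ∀ x i, u (x, i) ^ 2 = uc (x, i) ^ 2 + (u (x, i) - uc (x, i)) ^ 2 := by
    intro x i; rw [huc]; split_ifs <;> ring
  -- divergence of u = divergence of uc at interior sites
  have hdiv : ∑ x ∈ Fintype.piFinset (fun _ : Fin 4 => Finset.Icc (1 : ℤ) (N - 1)),
        (∑ i : Fin 4, (u (x - Pi.single i 1, i) - u (x, i))) ^ 2 =
      ∑ x ∈ Fintype.piFinset (fun _ : Fin 4 => Finset.Icc (1 : ℤ) (N - 1)),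
        (∑ i : Fin 4, (uc (x - Pi.single i 1, i) - uc (x, i))) ^ 2 := by
    refine Finset.sum_congr rfl fun x hx => ?_
    rw [mem_box] at hx
    congr 1
    refine Finset.sum_congr rfl fun i _ => ?_
    have h1 : uc (x, i) = u (x, i) := by
      rw [huc, if_pos]; intro k hk; have := hx k; constructor <;> omega
    have h2 : uc (x - Pi.single i 1, i) = u (x - Pi.single i 1, i) := by
      rw [huc, if_pos]; intro k hk
      have := hx k
      rw [Pi.sub_apply, Pi.single_eq_of_ne hk]
      constructor <;> omega
    rw [h1, h2]
  have hB := boundary_reduction hsupp uc huc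
  have hC := core_energy N uc hcsupp hccore
  -- nonnegativity facts
  have hFc : 0 ≤ ∑ z ∈ Fintype.piFinset (fun _ : Fin 4 => Finset.Icc (-2 : ℤ) (N + 2)), ∑ i : Fin 4, ∑ j : Fin 4,
      (if i < j then (uc (z, i) + uc (z + Pi.single i 1, j) - uc (z + Pi.single j 1, i) - uc (z, j)) ^ 2 else 0) :=
    Finset.sum_nonneg fun z _ => Finset.sum_nonneg fun i _ => Finset.sum_nonneg fun j _ => by split_ifs <;> positivity
  have hD0 : 0 ≤ ∑ x ∈ Fintype.piFinset (fun _ : Fin 4 => Finset.Icc (1 : ℤ) (N - 1)),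
      (∑ i : Fin 4, (uc (x - Pi.single i 1, i) - uc (x, i))) ^ 2 := Finset.sum_nonneg fun x _ => sq_nonneg _
  -- (1) the face-tangential value
  have ht : (u (x, i) - uc (x, i)) ^ 2 ≤
      ∑ x ∈ Fintype.piFinset (fun _ : Fin 4 => Finset.Icc (-2 : ℤ) (N + 2)), ∑ i : Fin 4, (u (x, i) - uc (x, i)) ^ 2 := by
    by_cases hx : ∀ k, 0 ≤ x k ∧ x k ≤ N
    · have hxB : x ∈ Fintype.piFinset (fun _ : Fin 4 => Finset.Icc (-2 : ℤ) ((N : ℤ) + 2)) := by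
        rw [mem_box]; intro k; have := hx k; constructor <;> omega
      refine le_trans ?_ (Finset.single_le_sum (f := fun x => ∑ i : Fin 4, (u (x, i) - uc (x, i)) ^ 2)
        (fun x _ => Finset.sum_nonneg fun i _ => sq_nonneg _) hxB)
      exact Finset.single_le_sum (f := fun i => (u (x, i) - uc (x, i)) ^ 2) (fun i _ => sq_nonneg _) (Finset.mem_univ i)
    · have h0 : u (x, i) = 0 := by by_contra h; exact hx (hsupp x i h).1
      have h1 : uc (x, i) = 0 := by rw [huc]; split_ifs <;> simp [h0]
      rw [h0, h1, sub_zero, zero_pow two_ne_zero]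
      exact Finset.sum_nonneg fun x _ => Finset.sum_nonneg fun i _ => sq_nonneg _
  -- (2) the core value: lattice Sobolev on the slice, then the core energy
  have hsob := lattice_sobolev N i (fun y => uc (y, i)) (fun y hy => ⟨hcsupp y i hy, hccore y i hy⟩) x
  have hslice : ∑ τ : Fin 4, (if τ ≠ i then
      ∑ y ∈ Fintype.piFinset (fun _ : Fin 4 => Finset.Icc (-2 : ℤ) (N + 2)),
        (uc (y + Pi.single τ 1, i) - uc (y, i)) ^ 2 else 0) ≤
      ∑ a : Fin 4, ∑ b : Fin 4, (if a ≠ b then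
        ∑ y ∈ Fintype.piFinset (fun _ : Fin 4 => Finset.Icc (-2 : ℤ) (N + 2)), (uc (y + Pi.single a 1, b) - uc (y, b)) ^ 2 else 0) := by
    refine Finset.sum_le_sum fun a _ => ?_
    exact Finset.single_le_sum (f := fun b => if a ≠ b then
        ∑ y ∈ Fintype.piFinset (fun _ : Fin 4 => Finset.Icc (-2 : ℤ) ((N : ℤ) + 2)), (uc (y + Pi.single a 1, b) - uc (y, b)) ^ 2
        else 0) (fun b _ => by split_ifs <;> [exact Finset.sum_nonneg fun y _ => sq_nonneg _; exact le_rfl]) (Finset.mem_univ i)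
  -- assemble
  rw [hnorm, hdiv]
  nlinarith [hsob, hslice, hC, hB, ht, hFc, hD0]

/-- **Matrix lemma**: a pointwise bound `w_e² ≤ c · wᵀQw` for all `w` gives `(Q⁻¹)_{ee} ≤ c` for a positive definite `Q`
(take `w = Q⁻¹ δ_e`, for which `wᵀQw = w_e = (Q⁻¹)_{ee}`). -/
theorem inv_diag_le_of_pointwise {ι : Type*} [Fintype ι] [DecidableEq ι] (Q : Matrix ι ι ℝ) (hQ : Q.PosDef) (e : ι)
    {c : ℝ} (hc : 0 ≤ c) (h : ∀ w : ι → ℝ, (w e) ^ 2 ≤ c * (w ⬝ᵥ Q *ᵥ w)) : Q⁻¹ e e ≤ c := by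
  set w := Q⁻¹ *ᵥ Pi.single e 1 with hw
  have hdet : IsUnit Q.det := (Matrix.isUnit_iff_isUnit_det Q).1 hQ.isUnit
  have hQw : Q *ᵥ w = Pi.single e 1 := by rw [hw, Matrix.mulVec_mulVec, Matrix.mul_nonsing_inv Q hdet, Matrix.one_mulVec]
  have hwe : w e = Q⁻¹ e e := by rw [hw, Matrix.mulVec_single_one]; rfl
  have hform : w ⬝ᵥ Q *ᵥ w = w e := by rw [hQw, dotProduct_single_one]
  have key := h w
  rw [hform] at key
  rw [← hwe]
  by_cases hpos : w e ≤ 0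
  · exact hpos.trans hc
  · push Not at hpos
    nlinarith

end HodgePoincare

open HodgePoincare

/-- **Pointwise bound of a free edge variable by the Hodge form**: `v_e² ≤ 1036 · vᵀ·hodgeQ H·v` for every `H`,
every free edge `e` and every configuration `v` (all `H`). -/
theorem sq_le_dotProduct_hodgeQ (H : ℕ) (e : LandauFree H) (v : LandauFree H → ℝ) :
    (v e) ^ 2 ≤ 1036 * (v ⬝ᵥ (hodgeQ H *ᵥ v)) := by
  have hsupp : ∀ x i, glue (pin := landauPin H) dirCorner (2 * H + 3) 0 v (x, i) ≠ 0 →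
      (∀ k, 0 ≤ x k ∧ x k ≤ ((2 * H : ℕ) : ℤ)) ∧ x i + 1 ≤ ((2 * H : ℕ) : ℤ) :=
    fun x i h => glue_supp H v x i h
  have key := sq_le_hodge (2 * H) (fun e' => glue (pin := landauPin H) dirCorner (2 * H + 3) 0 v e') hsupp e.1.1.1 e.1.1.2
  rw [← dotProduct_hodgeQ_eq H v] at key
  have hve : v e = glue (pin := landauPin H) dirCorner (2 * H + 3) 0 v (e.1.1.1, e.1.1.2) := by
    rw [Prod.mk.eta, glue_apply_free]
  rw [hve]
  exact key

/-- **S3a of LINE-19 «landau-sector-relative-bl» (crux `AllWindowsColdBox.BoxHighWindowsSU22`, stmt-QuantumFields-24004 / low item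
24335): bounded Landau variances.**  The diagonal of the inverse Hodge precision matrix of the cold box is bounded uniformly in `H`:
`(hodgeQ H)⁻¹_{ee} ≤ 1036` for every `H ≥ 1` and every free edge `e` (walls and corners included).  This is the first conjunct
`LandauVarianceBounded` of the registered stub S3 `stub_landauKernelBounds`; the decay conjunct `LandauKernelDecay` is NOT proved here. -/
theorem landauVarianceBounded : LandauVarianceBounded := by
  refine ⟨1036, fun H _ e => ?_⟩
  exact inv_diag_le_of_pointwise (hodgeQ H) (hodgeQ_posDef H) e (by norm_num) fun w => sq_le_dotProduct_hodgeQ H e w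

/-- **T4″ of the S4b bootstrap, unconditional**: the ℓ²-row of the gradient kernel is bounded, `Σ_p ((hodgeQ H)⁻¹λ_p)_e² ≤ C(1+log H)²`
(in fact `≤ 1036`, no log), by the tree's exact identity `sum_sq_gradKernel_le_diag` and `landauVarianceBounded`. -/
theorem gradKernelL2 : GradKernelL2 := gradKernelL2_of_varianceBounded landauVarianceBounded

end Summit.QuantumFields.YangMills.Theorems.AllWindowsColdBoxBoxHighLine
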